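import Summits.HodgeConjecture.CorCM.GaloisDihedralTimesTwoMirrorTypes
import Summits.HodgeConjecture.CorCM.CyclicAsymmetricCMHalvesTimesTwo
import Summits.HodgeConjecture.CorCM.GaloisSixteenAllTypes
import Summits.HodgeConjecture.CorCM.CMFieldSmallDegreeAllTypes
import HarnessLib

/-!
# The family `Gal(K/ℚ) ≅ D_{2n} × C₂` with complex conjugation `(rⁿ, 1)`: every simple CM abelian variety
# nondegenerate ⟺ `n ≤ 2` ⟺ every abelian variety with CM by `K` stably nondegenerate

COR-CM (cell `pub-hodgecm2`), binder seat b04 (gen 22), count-neutral claim GALOIS-DIHEDRAL, part VI — the companion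
family of the dihedral classification (part IV).  KERNEL ONLY: theorems; no definition, no named fact, no `sorry`.
`HC_CM` is neither used nor claimed.

`G₀ = DihedralGroup (2n) × Multiplicative (ZMod 2)` (order `8n`) with the CENTRAL INVOLUTION `c₀ = (rⁿ, 1)` (one of
the three; for `c₀ = (1, z)` or `(rⁿ, z)` the field contains an imaginary quadratic subfield and gen 19's capstone
applies; for `c₀ = (rⁿ, 1)` and `n` even EVERY index-`2` subgroup contains `c₀` — no imaginary quadratic subfield).
For a Galois CM field `K` with `e : Gal(K/ℚ) ≃* G₀`, `e(c) = (rⁿ, 1)`: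
* `n ≥ 4` (§2): the mirror types of part V on the aperiodic asymmetric CM halves of `ℤ/2n × ℤ/2` of part VI-a are
  PRIMITIVE and DEGENERATE;
* `n = 3` (§2, order `24`, the group `C₂² × S₃`): a kernel-decided certificate (rank `10` of `13`);
* `n = 1, 2` (§1, orders `8`, `16`): Galois octic (gen 13), resp. `GOOD16` — every square is `1` or `c` (gens 16–17,
  21) — so every primitive CM type is nondegenerate and every `X` with `K ↪ End⁰(X)`, `[K:ℚ] = 2 dim X` is stably
  nondegenerate.
§3 **THE CLASSIFICATION** `forall_isPrimitive_isNondegenerate_iff_dihedral₂` / `…isSimple…` / `…isStablyNondegenerate…`: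
GOOD ⟺ `n ≤ 2` ⟺ ALL-X; §4 the Hodge conjecture for all powers and everything isogenous (`n ≤ 2`), the dichotomy,
`HCOnClass`.  (Seat census, `scratch-g22/g22i.py`: `D₈(16) × C₂`, `c = (r⁴, 1)`: `184` of `1396` sampled primitive CM
sets degenerate — the gen-20 census row «`D₈(16) × C₂` bad» is now a theorem, with its infinite family.)

## References

* [Shimura1998] G. Shimura, *Abelian Varieties with Complex Multiplication and Modular Functions*, §5.1 Prop. 3,
  §6.2 Thm. 3, §8.2 Prop. 26.
* [Gordon1999HodgeAVSurvey] B. B. Gordon, *A survey of the Hodge conjecture for abelian varieties*, Thm. 6.3–6.4,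
  Def. 7.6, §9.3.
* [Dodson1984] B. Dodson, *The structure of Galois groups of CM-fields*, Trans. AMS 283 (1984), §3.3.2, §5.
* [Kubota1965] T. Kubota, Trans. AMS 118 (1965), §2.
-/

noncomputable section

open CategoryTheory CategoryTheory.Limits NumberField

namespace Summit.HodgeConjecture.CorCM.GaloisDihedralTimesTwo

open Literature.NumberTheory.ComplexMultiplication
open Literature.AlgebraicGeometry Literature.AlgebraicGeometry.Motives Literature.AlgebraicGeometry.HodgeTheory
open Literature.AlgebraicGeometry.Motives.AbelianVariety
open Literature.AlgebraicGeometry.ComplexMultiplication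
open Literature.AlgebraicGeometry.Pohlmann1968
open Literature.Barriers.HodgeConjecture (divisorClassesSpan)
open Summit.HodgeConjecture.HodgeConjecture.Ring2.ClassTargets
open Summit.HodgeConjecture.CorCM.GaloisRank
open Summit.HodgeConjecture.CorCM.GaloisModels
open Summit.HodgeConjecture.CorCM.AbelianSixteen (exists_simple_realisation_of_isPrimitive)
open Summit.HodgeConjecture.CorCM.CyclicAsymmetricHalvesTimesTwo
open DihedralGroup

variable {K : Type} [Field K] [NumberField K] [IsCMField K] [IsGalois ℚ K]
variable {n : ℕ}

/-! ## §1 Degree; the good cases `n = 1, 2` -/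

omit [IsCMField K] in
/-- `[K:ℚ] = 8n`. [folklore] -/
theorem finrank_eq_eight_mul (e : (K ≃ₐ[ℚ] K) ≃* DihedralGroup (2 * n) × Multiplicative (ZMod 2)) :
    Module.finrank ℚ K = 8 * n := by
  rw [← IsGalois.card_aut_eq_finrank, Nat.card_congr e.toEquiv, Nat.card_prod, DihedralGroup.nat_card,
    Nat.card_eq_fintype_card, Fintype.card_multiplicative, ZMod.card]
  ring

omit [IsCMField K] in
/-- `0 < n`. [folklore] -/
theorem pos_of_mulEquiv₂ (e : (K ≃ₐ[ℚ] K) ≃* DihedralGroup (2 * n) × Multiplicative (ZMod 2)) : 0 < n := by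
  have h := finrank_eq_eight_mul e
  have := Module.finrank_pos (R := ℚ) (M := K)
  omega

/-- In `D₄ × C₂` every square is `1` or `(r², 1)`. [folklore] -/
theorem sq_dihedral_four_times_two : ∀ y : DihedralGroup (2 * 2) × Multiplicative (ZMod 2),
    y * y = 1 ∨ y * y = (r 2, 1) := by
  decide

/-- **`n ≤ 2`: every PRIMITIVE CM type is NONDEGENERATE** (`n = 1`: Galois octic; `n = 2`: `GOOD16`, every square in
`Gal(K/ℚ)` is `1` or `c`). [cite: Dodson1984, §3.3.2 Theorem (p. 16)] [cite: Shimura1998, §8.2 Prop. 26] -/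
theorem isNondegenerate_of_isPrimitive_dihedral₂_of_le_two (hn : n ≤ 2)
    (e : (K ≃ₐ[ℚ] K) ≃* DihedralGroup (2 * n) × Multiplicative (ZMod 2))
    (hc : e ((IsCMField.complexConj K).restrictScalars ℚ) = (r (n : ZMod (2 * n)), 1))
    {Φ : CMType K} (φ₀ : K →+* ℂ) (hprim : IsPrimitive (ℂ ≃+* ℂ) Φ.1 φ₀) : IsNondegenerate Φ := by
  have hK := finrank_eq_eight_mul e
  have hpos := pos_of_mulEquiv₂ e
  rcases (show n = 1 ∨ n = 2 by omega) with rfl | rfl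
  · exact GaloisDodecic.isNondegenerate_of_isPrimitive_of_finrank_le_twelve (by omega) (fun _ => inferInstance)
      (fun h12 => by omega) φ₀ hprim
  · refine GaloisSixteenClassification.isNondegenerate_of_isPrimitive_of_good16 (by omega) (Or.inl fun g => ?_) φ₀ hprim
    simp only [Nat.cast_ofNat] at hc
    rcases sq_dihedral_four_times_two (e g) with h | h
    · left
      apply e.injective
      rw [map_mul, h, map_one]
    · right
      apply e.injective
      rw [map_mul, h, hc]

/-- **`n ≤ 2`: EVERY abelian variety `X` with `K ↪ End⁰(X)`, `[K:ℚ] = 2 dim X`, is STABLY NONDEGENERATE.**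
[cite: Gordon1999HodgeAVSurvey, Thm. 6.4 and Def. 7.6] [cite: Shimura1998, §5.1 Prop. 3 and §8.2 Prop. 26] -/
theorem isStablyNondegenerate_dihedral₂_of_le_two (hn : n ≤ 2)
    (e : (K ≃ₐ[ℚ] K) ≃* DihedralGroup (2 * n) × Multiplicative (ZMod 2))
    (hc : e ((IsCMField.complexConj K).restrictScalars ℚ) = (r (n : ZMod (2 * n)), 1))
    {X : AbelianVariety ℂ} (φ : K →+* X.endAlgebra) (hX : Module.finrank ℚ K = 2 * X.dim) :
    IsStablyNondegenerate X := by
  have hK := finrank_eq_eight_mul e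
  have hpos := pos_of_mulEquiv₂ e
  rcases (show n = 1 ∨ n = 2 by omega) with rfl | rfl
  · exact SmallDegreeAllTypes.isStablyNondegenerate_of_finrank_le_twelve (by omega) (fun _ => inferInstance)
      (fun h12 => by omega) φ hX
  · refine GaloisSixteenAllTypes.isStablyNondegenerate_of_good16 (by omega) (Or.inl fun g => ?_) φ hX
    simp only [Nat.cast_ofNat] at hc
    rcases sq_dihedral_four_times_two (e g) with h | h
    · left
      apply e.injective
      rw [map_mul, h, map_one]
    · right
      apply e.injective
      rw [map_mul, h, hc]

/-! ## §2 The bad cases: `n ≥ 4` by mirror types, `n = 3` by a certificate -/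

/-- **`n ≥ 4`: a primitive degenerate CM type** (mirror type of part V on the half of part VI-a).
[cite: Shimura1998, §8.2 Prop. 26] [cite: Gordon1999HodgeAVSurvey, §9.3] -/
theorem exists_isPrimitive_not_isNondegenerate_dihedral₂_of_four_le (hn : 4 ≤ n)
    (e : (K ≃ₐ[ℚ] K) ≃* DihedralGroup (2 * n) × Multiplicative (ZMod 2))
    (hc : e ((IsCMField.complexConj K).restrictScalars ℚ) = (r (n : ZMod (2 * n)), 1)) (φ₀ : K →+* ℂ) :
    ∃ Φ : CMType K, IsPrimitive (ℂ ≃+* ℂ) Φ.1 φ₀ ∧ ¬ IsNondegenerate Φ := by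
  haveI : NeZero n := ⟨by omega⟩
  obtain ⟨S, hS⟩ := exists_half₂ n
  have hc' : e ((IsCMField.complexConj K).restrictScalars ℚ) =
      (r ((((n : ℕ) : ZMod (2 * n)), (0 : ZMod 2)) : ZMod (2 * n) × ZMod 2).1,
        Multiplicative.ofAdd ((((n : ℕ) : ZMod (2 * n)), (0 : ZMod 2)) : ZMod (2 * n) × ZMod 2).2) := by
    rw [hc]; rfl
  exact exists_isPrimitive_not_isNondegenerate_of_mirror₂ e _ hc' S 0 (half₂_mem_iff_add_not_mem (by omega) hS)
    (fun j hj => half₂_aperiodic (by omega) hS hj) (half₂_asymmetric hn hS) φ₀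

/-- **`n ≥ 4`, realised: a simple degenerate abelian variety of dimension `4n` with CM by `K`.**
[cite: Shimura1998, §6.2 Thm. 3 and §8.2 Prop. 26] [cite: Gordon1999HodgeAVSurvey, Thm. 6.4] -/
theorem exists_simple_degenerate_dihedral₂_of_four_le (hn : 4 ≤ n)
    (e : (K ≃ₐ[ℚ] K) ≃* DihedralGroup (2 * n) × Multiplicative (ZMod 2))
    (hc : e ((IsCMField.complexConj K).restrictScalars ℚ) = (r (n : ZMod (2 * n)), 1)) :
    ∃ (Φ : CMType K) (φ₀ : K →+* ℂ) (A : AbelianVariety ℂ) (ι : 𝓞 K →+* End A)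
      (θ : K →+* Module.End ℂ (complexBetti A.X 1)),
      IsPrimitive (ℂ ≃+* ℂ) Φ.1 φ₀ ∧ ¬ IsNondegenerate Φ ∧ IsCMTypeRealisation Φ A ι θ ∧ A.IsSimple ∧
      A.dim = 4 * n ∧
      ∃ N p : ℕ, ∃ x : complexBetti (⨁ fun _ : Fin N => A).X (2 * p), IsRationalClass x ∧
        IsOfHodgeType (⨁ fun _ : Fin N => A).dim (⨁ fun _ : Fin N => A).X (2 * p) p p x ∧
        x ∉ divisorClassesSpan (⨁ fun _ : Fin N => A).X (⨁ fun _ : Fin N => A).dim p := by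
  haveI : NeZero n := ⟨by omega⟩
  obtain ⟨S, hS⟩ := exists_half₂ n
  have hc' : e ((IsCMField.complexConj K).restrictScalars ℚ) =
      (r ((((n : ℕ) : ZMod (2 * n)), (0 : ZMod 2)) : ZMod (2 * n) × ZMod 2).1,
        Multiplicative.ofAdd ((((n : ℕ) : ZMod (2 * n)), (0 : ZMod 2)) : ZMod (2 * n) × ZMod 2).2) := by
    rw [hc]; rfl
  have h := exists_simple_degenerate_of_mirror₂ e _ hc' S 0 (half₂_mem_iff_add_not_mem (by omega) hS)
    (fun j hj => half₂_aperiodic (by omega) hS hj) (half₂_asymmetric hn hS)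
  have h4 : 2 * (2 * n) = 4 * n := by ring
  rwa [h4] at h

/-- **`n = 3` (order `24`, `C₂² × S₃`): a primitive degenerate CM type by a kernel-decided certificate** (rank `10` of
`13`; balanced set `{(r_{2i}, 1), (r_{2i+1}, z)}`). [cite: Shimura1998, §8.2 Prop. 26] [cite: Gordon1999HodgeAVSurvey, §9.3] -/
theorem exists_isPrimitive_not_isNondegenerate_dihedral₂_three
    (e : (K ≃ₐ[ℚ] K) ≃* DihedralGroup 6 × Multiplicative (ZMod 2))
    (hc : e ((IsCMField.complexConj K).restrictScalars ℚ) = (r 3, 1)) (φ₀ : K →+* ℂ) :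
    ∃ Φ : CMType K, IsPrimitive (ℂ ≃+* ℂ) Φ.1 φ₀ ∧ ¬ IsNondegenerate Φ :=
  exists_isPrimitive_not_isNondegenerate_of_model_balanced e (r 3, 1) hc
    {(r 0, Multiplicative.ofAdd 0), (r 1, Multiplicative.ofAdd 0), (r 2, Multiplicative.ofAdd 0),
      (r 0, Multiplicative.ofAdd 1), (r 1, Multiplicative.ofAdd 1), (r 2, Multiplicative.ofAdd 1),
      (sr 0, Multiplicative.ofAdd 0), (sr 1, Multiplicative.ofAdd 0), (sr 2, Multiplicative.ofAdd 0),
      (sr 0, Multiplicative.ofAdd 1), (sr 4, Multiplicative.ofAdd 1), (sr 5, Multiplicative.ofAdd 1)}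
    (by decide) (by decide)
    {(r 0, Multiplicative.ofAdd 0), (r 1, Multiplicative.ofAdd 1), (r 2, Multiplicative.ofAdd 0),
      (r 3, Multiplicative.ofAdd 1), (r 4, Multiplicative.ofAdd 0), (r 5, Multiplicative.ofAdd 1)}
    (by decide) (by decide) φ₀

/-- **`n = 3`, realised: a simple degenerate abelian 12-fold with CM by `K`.** [cite: Shimura1998, §6.2 Thm. 3 and §8.2 Prop. 26]
[cite: Gordon1999HodgeAVSurvey, Thm. 6.4] -/
theorem exists_simple_degenerate_dihedral₂_three (e : (K ≃ₐ[ℚ] K) ≃* DihedralGroup 6 × Multiplicative (ZMod 2))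
    (hc : e ((IsCMField.complexConj K).restrictScalars ℚ) = (r 3, 1)) :
    ∃ (Φ : CMType K) (φ₀ : K →+* ℂ) (A : AbelianVariety ℂ) (ι : 𝓞 K →+* End A)
      (θ : K →+* Module.End ℂ (complexBetti A.X 1)),
      IsPrimitive (ℂ ≃+* ℂ) Φ.1 φ₀ ∧ ¬ IsNondegenerate Φ ∧ IsCMTypeRealisation Φ A ι θ ∧ A.IsSimple ∧
      A.dim = 12 ∧
      ∃ N p : ℕ, ∃ x : complexBetti (⨁ fun _ : Fin N => A).X (2 * p), IsRationalClass x ∧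
        IsOfHodgeType (⨁ fun _ : Fin N => A).dim (⨁ fun _ : Fin N => A).X (2 * p) p p x ∧
        x ∉ divisorClassesSpan (⨁ fun _ : Fin N => A).X (⨁ fun _ : Fin N => A).dim p := by
  have h := exists_simple_degenerate_of_model_balanced e (r 3, 1) hc
    {(r 0, Multiplicative.ofAdd 0), (r 1, Multiplicative.ofAdd 0), (r 2, Multiplicative.ofAdd 0),
      (r 0, Multiplicative.ofAdd 1), (r 1, Multiplicative.ofAdd 1), (r 2, Multiplicative.ofAdd 1),
      (sr 0, Multiplicative.ofAdd 0), (sr 1, Multiplicative.ofAdd 0), (sr 2, Multiplicative.ofAdd 0),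
      (sr 0, Multiplicative.ofAdd 1), (sr 4, Multiplicative.ofAdd 1), (sr 5, Multiplicative.ofAdd 1)}
    (by decide) (by decide)
    {(r 0, Multiplicative.ofAdd 0), (r 1, Multiplicative.ofAdd 1), (r 2, Multiplicative.ofAdd 0),
      (r 3, Multiplicative.ofAdd 1), (r 4, Multiplicative.ofAdd 0), (r 5, Multiplicative.ofAdd 1)}
    (by decide) (by decide)
  have hcard : Fintype.card (DihedralGroup 6 × Multiplicative (ZMod 2)) / 2 = 12 := by decide
  rwa [hcard] at h

/-- **THEOREM (type level).  `Gal(K/ℚ) ≅ D_{2n} × C₂` with `c = (rⁿ, 1)` and `n ≥ 3`: a PRIMITIVE DEGENERATE CM type.**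
[cite: Shimura1998, §8.2 Prop. 26] [cite: Kubota1965, §2] -/
theorem exists_isPrimitive_not_isNondegenerate_dihedral₂ (hn : 3 ≤ n)
    (e : (K ≃ₐ[ℚ] K) ≃* DihedralGroup (2 * n) × Multiplicative (ZMod 2))
    (hc : e ((IsCMField.complexConj K).restrictScalars ℚ) = (r (n : ZMod (2 * n)), 1)) (φ₀ : K →+* ℂ) :
    ∃ Φ : CMType K, IsPrimitive (ℂ ≃+* ℂ) Φ.1 φ₀ ∧ ¬ IsNondegenerate Φ := by
  rcases (show n = 3 ∨ 4 ≤ n by omega) with rfl | h4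
  · simp only [Nat.cast_ofNat] at hc
    exact exists_isPrimitive_not_isNondegenerate_dihedral₂_three e hc φ₀
  · exact exists_isPrimitive_not_isNondegenerate_dihedral₂_of_four_le h4 e hc φ₀

/-- **THEOREM.  `Gal(K/ℚ) ≅ D_{2n} × C₂` with `c = (rⁿ, 1)` and `n ≥ 3`: a SIMPLE DEGENERATE abelian variety of
dimension `4n` with CM by `K`**, with an exceptional Hodge class on some power. [cite: Shimura1998, §6.2 Thm. 3 and §8.2 Prop. 26]
[cite: Gordon1999HodgeAVSurvey, Thm. 6.4] -/
theorem exists_simple_degenerate_of_mulEquiv_dihedral₂ (hn : 3 ≤ n)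
    (e : (K ≃ₐ[ℚ] K) ≃* DihedralGroup (2 * n) × Multiplicative (ZMod 2))
    (hc : e ((IsCMField.complexConj K).restrictScalars ℚ) = (r (n : ZMod (2 * n)), 1)) :
    ∃ (Φ : CMType K) (φ₀ : K →+* ℂ) (A : AbelianVariety ℂ) (ι : 𝓞 K →+* End A)
      (θ : K →+* Module.End ℂ (complexBetti A.X 1)),
      IsPrimitive (ℂ ≃+* ℂ) Φ.1 φ₀ ∧ ¬ IsNondegenerate Φ ∧ IsCMTypeRealisation Φ A ι θ ∧ A.IsSimple ∧
      A.dim = 4 * n ∧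
      ∃ N p : ℕ, ∃ x : complexBetti (⨁ fun _ : Fin N => A).X (2 * p), IsRationalClass x ∧
        IsOfHodgeType (⨁ fun _ : Fin N => A).dim (⨁ fun _ : Fin N => A).X (2 * p) p p x ∧
        x ∉ divisorClassesSpan (⨁ fun _ : Fin N => A).X (⨁ fun _ : Fin N => A).dim p := by
  rcases (show n = 3 ∨ 4 ≤ n by omega) with rfl | h4
  · simp only [Nat.cast_ofNat] at hc
    exact exists_simple_degenerate_dihedral₂_three e hc
  · exact exists_simple_degenerate_dihedral₂_of_four_le h4 e hc

/-! ## §3 THE CLASSIFICATION of the family -/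

/-- **CLASSIFICATION (type level): `Gal(K/ℚ) ≅ D_{2n} × C₂`, `c = (rⁿ, 1)`: every PRIMITIVE CM type nondegenerate ⟺
`n ≤ 2`.** [cite: Kubota1965, §2] [cite: Shimura1998, §8.2 Prop. 26] [cite: Dodson1984, §3.3.2] -/
theorem forall_isPrimitive_isNondegenerate_iff_dihedral₂
    (e : (K ≃ₐ[ℚ] K) ≃* DihedralGroup (2 * n) × Multiplicative (ZMod 2))
    (hc : e ((IsCMField.complexConj K).restrictScalars ℚ) = (r (n : ZMod (2 * n)), 1)) :
    (∀ (Φ : CMType K) (φ₀ : K →+* ℂ), IsPrimitive (ℂ ≃+* ℂ) Φ.1 φ₀ → IsNondegenerate Φ) ↔ n ≤ 2 := by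
  refine ⟨fun h => ?_, fun hn Φ φ₀ hprim => isNondegenerate_of_isPrimitive_dihedral₂_of_le_two hn e hc φ₀ hprim⟩
  by_contra hlt
  obtain ⟨φ₀⟩ := (inferInstance : Nonempty (K →+* ℂ))
  obtain ⟨Φ, hprim, hdeg⟩ := exists_isPrimitive_not_isNondegenerate_dihedral₂ (by omega) e hc φ₀
  exact hdeg (h Φ φ₀ hprim)

/-- **CLASSIFICATION (simple abelian varieties)**: every SIMPLE abelian variety with CM by `K` is nondegenerate ⟺
`n ≤ 2`. [cite: Gordon1999HodgeAVSurvey, Thm. 6.4] [cite: Shimura1998, §6.2 Thm. 3 and §8.2 Prop. 26] -/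
theorem forall_isSimple_isNondegenerate_iff_dihedral₂
    (e : (K ≃ₐ[ℚ] K) ≃* DihedralGroup (2 * n) × Multiplicative (ZMod 2))
    (hc : e ((IsCMField.complexConj K).restrictScalars ℚ) = (r (n : ZMod (2 * n)), 1)) :
    (∀ (Φ : CMType K) (A : AbelianVariety ℂ) (ι : 𝓞 K →+* End A) (θ : K →+* Module.End ℂ (complexBetti A.X 1)),
      IsCMTypeRealisation Φ A ι θ → A.IsSimple → IsNondegenerate Φ) ↔ n ≤ 2 := by
  rw [← forall_isPrimitive_isNondegenerate_iff_dihedral₂ e hc]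
  constructor
  · intro h Φ φ₀ hprim
    obtain ⟨A, ι, θ, hA, hs, -⟩ := exists_simple_realisation_of_isPrimitive Φ φ₀ hprim
    exact h Φ A ι θ hA hs
  · intro h Φ A ι θ hA hs
    obtain ⟨φ₀⟩ := (inferInstance : Nonempty (K →+* ℂ))
    exact h Φ φ₀ ((isSimple_iff_isPrimitive hA φ₀).1 hs)

/-- **CLASSIFICATION (all abelian varieties)**: every `X` with `K ↪ End⁰(X)`, `[K:ℚ] = 2 dim X`, is stably
nondegenerate ⟺ `n ≤ 2`. [cite: Gordon1999HodgeAVSurvey, Thm. 6.4 and Def. 7.6] [cite: Shimura1998, §8.2 Prop. 26] -/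
theorem forall_isStablyNondegenerate_iff_dihedral₂
    (e : (K ≃ₐ[ℚ] K) ≃* DihedralGroup (2 * n) × Multiplicative (ZMod 2))
    (hc : e ((IsCMField.complexConj K).restrictScalars ℚ) = (r (n : ZMod (2 * n)), 1)) :
    (∀ (X : AbelianVariety ℂ) (_ : K →+* X.endAlgebra), Module.finrank ℚ K = 2 * X.dim → IsStablyNondegenerate X) ↔
      n ≤ 2 := by
  refine ⟨fun h => ?_, fun hn X φ hX => isStablyNondegenerate_dihedral₂_of_le_two hn e hc φ hX⟩
  by_contra hlt
  obtain ⟨Φ, φ₀, A, ι, θ, hprim, hdeg, hA, -, -, -⟩ := exists_simple_degenerate_of_mulEquiv_dihedral₂ (by omega) e hc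
  obtain ⟨i, -⟩ := exists_ringHom_endAlgebra ι
  exact hdeg ((isStablyNondegenerate_iff_isNondegenerate φ₀ hprim hA).1
    (h A i (finrank_eq_two_mul_dim_of_isCMTypeRealisation hA)))

/-! ## §4 The Hodge conjecture for `n ≤ 2`; the dichotomy -/

variable {Φ : CMType K} {A : AbelianVariety ℂ} {ι : 𝓞 K →+* End A} {θ : K →+* Module.End ℂ (complexBetti A.X 1)}

/-- **The Hodge conjecture for every power of every abelian variety with CM by `K`** (`Gal ≅ D_{2n} × C₂`,
`c = (rⁿ, 1)`, `n ≤ 2`) — unconditionally, no simplicity. [cite: Gordon1999HodgeAVSurvey, 5.13 (i) and Thm. 6.4] -/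
theorem hodgeConjectureFor_pow_dihedral₂_of_le_two (hn : n ≤ 2)
    (e : (K ≃ₐ[ℚ] K) ≃* DihedralGroup (2 * n) × Multiplicative (ZMod 2))
    (hc : e ((IsCMField.complexConj K).restrictScalars ℚ) = (r (n : ZMod (2 * n)), 1))
    (hA : IsCMTypeRealisation Φ A ι θ) (N : ℕ) :
    HodgeConjectureFor (⨁ fun _ : Fin N => A).dim (⨁ fun _ : Fin N => A).X := by
  obtain ⟨i, -⟩ := exists_ringHom_endAlgebra ι
  exact hodgeConjectureFor_of_isDivisorGenerated _
    ((isStablyNondegenerate_iff_forall_isDivisorGenerated_biproduct A).1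
      (isStablyNondegenerate_dihedral₂_of_le_two hn e hc i (finrank_eq_two_mul_dim_of_isCMTypeRealisation hA)) N)

/-- **… and for everything isogenous to a power of an `X` with `K ↪ End⁰(X)`** (`n ≤ 2`).
[cite: Gordon1999HodgeAVSurvey, Thm. 6.3–6.4] -/
theorem hodgeConjectureFor_of_isIsogenous_powSucc_dihedral₂_of_le_two (hn : n ≤ 2)
    (e : (K ≃ₐ[ℚ] K) ≃* DihedralGroup (2 * n) × Multiplicative (ZMod 2))
    (hc : e ((IsCMField.complexConj K).restrictScalars ℚ) = (r (n : ZMod (2 * n)), 1))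
    {X : AbelianVariety ℂ} (φ : K →+* X.endAlgebra) (hX : Module.finrank ℚ K = 2 * X.dim) {B : AbelianVariety ℂ}
    {N : ℕ} (h : IsIsogenous B (X.powSucc N)) : HodgeConjectureFor B.dim B.X :=
  (isStablyNondegenerate_dihedral₂_of_le_two hn e hc φ hX).hodgeConjectureFor_of_isIsogenous_powSucc h

/-- **Dichotomy display** for the family. [cite: Gordon1999HodgeAVSurvey, Thm. 6.4] [cite: Shimura1998, §6.2 Thm. 3] -/
theorem hodgeConjectureFor_pow_or_exists_simple_degenerate_dihedral₂
    (e : (K ≃ₐ[ℚ] K) ≃* DihedralGroup (2 * n) × Multiplicative (ZMod 2))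
    (hc : e ((IsCMField.complexConj K).restrictScalars ℚ) = (r (n : ZMod (2 * n)), 1)) :
    (∀ (Φ : CMType K) (A : AbelianVariety ℂ) (ι : 𝓞 K →+* End A) (θ : K →+* Module.End ℂ (complexBetti A.X 1)),
      IsCMTypeRealisation Φ A ι θ → ∀ N : ℕ,
        HodgeConjectureFor (⨁ fun _ : Fin N => A).dim (⨁ fun _ : Fin N => A).X) ∨
    (∃ (Φ : CMType K) (φ₀ : K →+* ℂ) (A : AbelianVariety ℂ) (ι : 𝓞 K →+* End A)
      (θ : K →+* Module.End ℂ (complexBetti A.X 1)),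
      IsPrimitive (ℂ ≃+* ℂ) Φ.1 φ₀ ∧ ¬ IsNondegenerate Φ ∧ IsCMTypeRealisation Φ A ι θ ∧ A.IsSimple ∧
      A.dim = 4 * n) := by
  by_cases hn : n ≤ 2
  · exact Or.inl fun Φ A ι θ hA N => hodgeConjectureFor_pow_dihedral₂_of_le_two hn e hc hA N
  · right
    obtain ⟨Φ, φ₀, A, ι, θ, hprim, hdeg, hA, hs, hdim, -⟩ :=
      exists_simple_degenerate_of_mulEquiv_dihedral₂ (by omega) e hc
    exact ⟨Φ, φ₀, A, ι, θ, hprim, hdeg, hA, hs, hdim⟩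

/-- **HC on the class «isogenous to a power of an `X` with an action of a Galois CM field of degree `2 dim X` whose
Galois group is `D_{2n} × C₂` with complex conjugation `(rⁿ, 1)`, `n ≤ 2`»** — UNCONDITIONAL.
[cite: Gordon1999HodgeAVSurvey, Thm. 6.3–6.4] -/
theorem hcOnClass_isIsogenous_powSucc_galoisCM_dihedral₂ :
    HCOnClass fun B ↦ ∃ (X : AbelianVariety ℂ) (N : ℕ) (K : Type) (_ : Field K) (_ : NumberField K)
      (_ : IsCMField K) (_ : IsGalois ℚ K) (n : ℕ) (e : (K ≃ₐ[ℚ] K) ≃* DihedralGroup (2 * n) × Multiplicative (ZMod 2)),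
      n ≤ 2 ∧ e ((IsCMField.complexConj K).restrictScalars ℚ) = (r (n : ZMod (2 * n)), 1) ∧
      Module.finrank ℚ K = 2 * X.dim ∧ Nonempty (K →+* X.endAlgebra) ∧ IsIsogenous B (X.powSucc N) := by
  rintro B ⟨X, N, K, _, _, _, _, n, e, hn, hc, hX, ⟨φ⟩, h⟩
  exact (isStablyNondegenerate_dihedral₂_of_le_two hn e hc φ hX).hodgeConjectureFor_of_isIsogenous_powSucc h

end Summit.HodgeConjecture.CorCM.GaloisDihedralTimesTwo

end
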